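import Literature.NumberTheory.Sieve.LinearSieveExistence
import Literature.NumberTheory.Sieve.EulerMascheroniEin
import HarnessLib

/-!
# The constant of the linear sieve: `A_1 = 2e^γ`, `F_1(s) = 2e^γ/s`, `f_1(s) = 2e^γ log(s − 1)/s`

Trunk `AntSieve` (topic `NumberTheory/Sieve`). `LinearSieveExistence` proves that the canonical
linear-sieve data of `SieveFunctions` exist, with `β_1 = 2` and
`A_1 = betaSieveConst 1 = 2/p_1(1)`; `EulerMascheroniEin` proves `p_1(1) = e^{−γ}`
[Greaves2001, Lemma 4.2.4 (ii)]. Hence `A_1 = 2e^γ` [Greaves2001, Lemma 4.2.5: "`C = 2e^γ` when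
`κ = 1`"], and the named facts `upperSieveFun_one_eq` (`F_1(s) = 2e^γ/s` on `(0, 3]`) and
`lowerSieveFun_one_eq` (`f_1(s) = 2e^γ log(s − 1)/s` on `[2, 4]`) of `SieveFunctions`
[Greaves2001, (4.2.4.16); JurkatRichertActaArith1965] are DISCHARGED here.

## References

* [Greaves2001] G. Greaves, *Sieves in Number Theory*, Springer (2001), §4.2.4 Lemma 4.2.5, (4.16).
* [JurkatRichertActaArith1965] W. B. Jurkat, H.-E. Richert, Acta Arith. 11 (1965), Thm 4–5.
-/

open Filter Asymptotics Set Topology MeasureTheory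

noncomputable section

namespace Literature.NumberTheory.Sieve

/-! ### `A_1 = 2e^γ` and the discharges -/

/-- **`A_1 = 2e^γ`**: `betaSieveConst 1 = 2e^γ` [Greaves2001, Lemma 4.2.5: "`C = 2e^γ` when
`κ = 1`"]. [cite: Greaves2001, Lemma 4.2.5 (4.11)] -/
theorem betaSieveConst_one_eq_two_mul_exp :
    betaSieveConst 1 = 2 * Real.exp Real.eulerMascheroniConstant := by
  rw [betaSieveConst_one_eq, rosserAdjointP_one_one, Real.exp_neg, div_inv_eq_mul]

/-- `iwaniecSieveConst 1 = 2e^γ` as well (Iwaniec's pin). [cite: Greaves2001, Lemma 4.2.5 (4.11)] -/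
theorem iwaniecSieveConst_one_eq_two_mul_exp :
    iwaniecSieveConst 1 = 2 * Real.exp Real.eulerMascheroniConstant := by
  rw [← betaSieveConst_one, betaSieveConst_one_eq_two_mul_exp]

/-- **Discharge of the named fact `upperSieveFun_one_eq`** of `SieveFunctions`
(Jurkat–Richert; [Greaves2001, (4.2.4.16)]): `F_1(s) = 2e^γ/s` for `0 < s ≤ 3`.
[cite: Greaves2001, §4.2.4 (4.16)] -/
theorem upperSieveFun_one_eq_holds : upperSieveFun_one_eq := by
  intro s hs
  rw [upperSieveFun_one_eq_div hs, rosserAdjointP_one_one, Real.exp_neg, div_inv_eq_mul]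

/-- **Discharge of the named fact `lowerSieveFun_one_eq`** of `SieveFunctions`
(Jurkat–Richert; [Greaves2001, (4.2.4.16)]): `f_1(s) = 2e^γ log(s − 1)/s` for `2 ≤ s ≤ 4`
(integrate `(s f_1(s))' = F_1(s − 1) = 2e^γ/(s − 1)` from `2`, where `f_1(2) = 0`).
[cite: Greaves2001, §4.2.4 (4.16)] -/
theorem lowerSieveFun_one_eq_holds : lowerSieveFun_one_eq := by
  intro s hs
  set A : ℝ := 2 * Real.exp Real.eulerMascheroniConstant with hA
  have h := isBetaSieveSolution_upperSieveFun_one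
  have hβ : siftingLimit 1 = 2 := siftingLimit_one_holds
  have hAc : betaSieveConst 1 = A := betaSieveConst_one_eq_two_mul_exp
  have hf2 : lowerSieveFun 1 2 = 0 := h.lower_eq 2 (by rw [hβ]; norm_num)
  rcases hs.1.eq_or_lt with h2 | h2
  · rw [← h2, hf2]; norm_num
  have hs0 : 0 < s := by linarith
  -- `G t = t f(t)` has derivative `A (t - 1)⁻¹` on `(2, s)`
  set G : ℝ → ℝ := fun t => t ^ (1 : ℝ) * lowerSieveFun 1 t with hG
  have hGd : ∀ t ∈ Ioo 2 s, HasDerivAt G (A * (t - 1)⁻¹) t := by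
    intro t ht
    have h1 := h.hasDerivAt_lower t (by rw [hβ]; exact ht.1)
    have hF : upperSieveFun 1 (t - 1) = A * (t - 1)⁻¹ := by
      rw [h.upper_eq (t - 1) (by rw [hβ]; constructor <;> linarith [ht.1, ht.2, hs.2]), hAc,
        Real.rpow_neg_one]
    refine h1.congr_deriv ?_
    rw [hF]; norm_num
  have hGc : ContinuousOn G (Icc 2 s) := by
    refine ContinuousOn.mul (fun t ht => ?_) (h.continuousOn_lower.mono fun t ht => ?_)
    · exact (Real.continuousAt_rpow_const _ _ (Or.inl (by linarith [ht.1]))).continuousWithinAt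
    · exact show (0 : ℝ) < t by linarith [ht.1]
  have hint : IntervalIntegrable (fun t : ℝ => A * (t - 1)⁻¹) volume 2 s := by
    refine ContinuousOn.intervalIntegrable ?_
    rw [uIcc_of_le hs.1]
    refine continuousOn_const.mul ((continuousOn_id.sub continuousOn_const).inv₀ fun t ht => ?_)
    show id t - 1 ≠ 0
    simp only [id]
    linarith [ht.1]
  have hFTC := intervalIntegral.integral_eq_sub_of_hasDerivAt_of_le hs.1 hGc hGd hint
  have hI : ∫ t in (2 : ℝ)..s, A * (t - 1)⁻¹ = A * Real.log (s - 1) := by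
    rw [intervalIntegral.integral_const_mul,
      intervalIntegral.integral_comp_sub_right (fun t => t⁻¹) 1,
      integral_inv_of_pos (by norm_num) (by linarith)]
    norm_num
  have hG2 : G 2 = 0 := by simp [hG, hf2]
  have hGs : G s = s * lowerSieveFun 1 s := by simp [hG]
  rw [hI, hG2, sub_zero, hGs] at hFTC
  field_simp
  linarith

end Literature.NumberTheory.Sieve
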